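import Summits.CriticalPhenomena.PercolationContinuityZ3.Theorems.PercNearOneGluingNoHeavyLowerTailSahiTwoChainWRPullback
import Summits.CriticalPhenomena.PercolationContinuityZ3.Theorems.PercNearOneGluingNoHeavyLowerTailSahiCombTensorisation
import HarnessLib

/-!
# Comb hierarchy: BICHAIN FAMILIES ARE COMB-POSITIVE AT EVERY ORDER (TCP on the cube)

Support file of the one-cut programme (crux `NoHeavyLowerTail`, stmt-CriticalPhenomena-4575; cell `prim-masterthm`, seat P3, gen 16;
`run/shared/lean/prim/prim-masterthm/prim-masterthm-p3/HIERARCHY.md` §24; memo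
`run/shared/lean/prim/prim-masterthm/FROM-prim-masterthm-p3-g16-TWO-CHAIN-COEFFICIENTS.md` §3(iii)).

THE CLASS.  A cube `2^ι` with its product measures `μ_p`, a block `F ⊆ ι`, two "chain statistics" `ℓ₁ : Set ι → α` reading only the
coordinates in `F` and `ℓ₂ : Set ι → β` reading only those outside `F` (`α, β` finite chains; e.g. numbers of leading ones, levels in two
nested chains of up-sets, threshold counts), and functions `ω ↦ f_i(ℓ₁ ω, ℓ₂ ω)` with `f_i ≥ 0` monotone on `α × β` ("bichain families";
all two-block staircase functions `∨_r x_1⋯x_{a_r}·x'_1⋯x'_{b_r}` are of this form).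
THE THEOREM (**`combPos_sahiE_biChain`**): `p ↦ E_n(μ_p; f ∘ (ℓ₁, ℓ₂))` is COMB-POSITIVE of multidegree `n` (`SahiComb.CombPos`, the
certificate class of (M⁺-n), `…SahiCombMasterFamily`) — for EVERY `n`.  Proof: the resampling coupling (`SahiCombTensor.sahiE_bernoulliWeight_eq_couple`)
makes `μ_p` the image of `μ_p ⊗ μ_p`; TCP pulled back (`sahiE_comp_prodMap_eq_sum_et`) writes `E_n` as `Σ_{r,c} Π_a μ_p(ℓ₁ = r_a)·Π_b μ_p(ℓ₂ = c_b)·κ(r,c)`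
with `κ ≥ 0`; each block probability is comb-positive of multidegree `1` on its block and ignores the other block
(`combPos_ex_ind`, `CombPos.of_ignores_finset`), so every term has multidegree `n·1_F + n·1_{Fᶜ} = n`.
A genuinely two-dimensional class for the comb hierarchy, transversal to cores ≤ 3, chains/meet-absorbing families, cylinders, juntas and read-once
families (HIERARCHY §9–§19); its value shadow is P2's `SahiBiChainPullback.sahiE_comp_prodMap_nonneg`.  HONEST FRAMING: nothing here asserts (M⁺-k)
or `C_k` in general.  Everything PROVED, standard axioms; no new definitions. [this work]
-/

noncomputable section

open scoped Classical

namespace Summit.CriticalPhenomena.PercolationContinuityZ3.Theorems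

open Finset Function
open Literature.Combinatorics.Sahi2008
open Literature.Probability.Percolation.DecisionTree (ind ind_of_mem ind_of_not_mem ind_nonneg)
open SahiComb

namespace SahiTwoChain

variable {ι : Type} [Fintype ι] {α β : Type*} [Fintype α] [Fintype β]

/-- A push-forward mass of `μ_p` is the probability of a fibre. [this work] -/
theorem pushWeight_bernoulliWeight_eq_ex_ind (p : ι → unitInterval) {γ : Type*} (ℓ : Set ι → γ) (c : γ) :
    pushWeight (bernoulliWeight p) ℓ c = ex (bernoulliWeight p) (ind {ω | ℓ ω = c}) := by
  rw [pushWeight_eq_ex]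
  refine congrArg _ (funext fun ω => ?_)
  by_cases h : ℓ ω = c
  · rw [if_pos h, ind_of_mem (by simpa using h)]
  · rw [if_neg h, ind_of_not_mem (by simpa using h)]

/-- **A block probability is comb-positive of multidegree `1` on its block**: if `ℓ` reads only the coordinates of `F` then
`p ↦ μ_p(ℓ = c)` has a certificate of multidegree `1_F`. [this work] -/
theorem combPos_pushWeight_of_block (F : Finset ι) {γ : Type*} (ℓ : Set ι → γ) (hℓ : ∀ ω, ℓ ω = ℓ (ω ∩ ↑F)) (c : γ) :
    CombPos (fun e => if e ∈ Fᶜ then 0 else 1) (fun p => pushWeight (bernoulliWeight p) ℓ c) := by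
  have h1 : CombPos (fun _ : ι => 1) (fun p => pushWeight (bernoulliWeight p) ℓ c) :=
    (combPos_ex_ind {ω | ℓ ω = c}).congr fun p => pushWeight_bernoulliWeight_eq_ex_ind p ℓ c
  refine h1.of_ignores_finset Fᶜ fun e he p s => ?_
  rw [pushWeight_bernoulliWeight_eq_ex_ind, pushWeight_bernoulliWeight_eq_ex_ind, ← sahiE_one, ← sahiE_one]
  refine SahiCombTensor.sahiE_bernoulliWeight_update_eq_of_diff p (↑F : Set ι)ᶜ ![ind {ω | ℓ ω = c}] (fun i ω => ?_)
    (by simpa [Finset.mem_compl] using he) s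
  have hi : i = 0 := Subsingleton.elim i 0
  subst hi
  have hω : ℓ (ω \ (↑F : Set ι)ᶜ) = ℓ ω := by
    rw [Set.sdiff_compl, ← hℓ ω]
  simp only [Matrix.cons_val_zero]
  by_cases h : ℓ ω = c
  · rw [ind_of_mem (show ω ∈ {ω | ℓ ω = c} from h), ind_of_mem (show ω \ (↑F : Set ι)ᶜ ∈ {ω | ℓ ω = c} from hω.trans h)]
  · rw [ind_of_not_mem (show ω ∉ {ω | ℓ ω = c} from h),
      ind_of_not_mem (show ω \ (↑F : Set ι)ᶜ ∉ {ω | ℓ ω = c} from fun h' => h (hω.symm.trans h'))]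

/-- The complementary block: if `ℓ` reads only the coordinates outside `F` then `p ↦ μ_p(ℓ = c)` has a certificate of multidegree `1_{Fᶜ}`.
[this work] -/
theorem combPos_pushWeight_of_coblock (F : Finset ι) {γ : Type*} (ℓ : Set ι → γ) (hℓ : ∀ ω, ℓ ω = ℓ (ω \ ↑F)) (c : γ) :
    CombPos (fun e => if e ∈ F then 0 else 1) (fun p => pushWeight (bernoulliWeight p) ℓ c) := by
  have h1 : CombPos (fun _ : ι => 1) (fun p => pushWeight (bernoulliWeight p) ℓ c) :=
    (combPos_ex_ind {ω | ℓ ω = c}).congr fun p => pushWeight_bernoulliWeight_eq_ex_ind p ℓ c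
  refine h1.of_ignores_finset F fun e he p s => ?_
  rw [pushWeight_bernoulliWeight_eq_ex_ind, pushWeight_bernoulliWeight_eq_ex_ind, ← sahiE_one, ← sahiE_one]
  refine SahiCombTensor.sahiE_bernoulliWeight_update_eq_of_diff p (↑F : Set ι) ![ind {ω | ℓ ω = c}] (fun i ω => ?_)
    (by simpa using he) s
  have hi : i = 0 := Subsingleton.elim i 0
  subst hi
  have hω : ℓ (ω \ (↑F : Set ι)) = ℓ ω := (hℓ ω).symm
  simp only [Matrix.cons_val_zero]
  by_cases h : ℓ ω = c
  · rw [ind_of_mem (show ω ∈ {ω | ℓ ω = c} from h), ind_of_mem (show ω \ (↑F : Set ι) ∈ {ω | ℓ ω = c} from hω.trans h)]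
  · rw [ind_of_not_mem (show ω ∉ {ω | ℓ ω = c} from h),
      ind_of_not_mem (show ω \ (↑F : Set ι) ∉ {ω | ℓ ω = c} from fun h' => h (hω.symm.trans h'))]

/-- **BICHAIN FAMILIES ARE COMB-POSITIVE AT EVERY ORDER.**  `F ⊆ ι` a block; `ℓ₁` reads only `F`, `ℓ₂` only `Fᶜ`, with values in finite chains
`α, β`; `f_0,…,f_{n−1} ≥ 0` monotone on `α × β`.  Then `p ↦ E_n(μ_p; (ω ↦ f_i(ℓ₁ ω, ℓ₂ ω))_i)` is a nonnegative combination of tensor-Bernstein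
monomials of multidegree `n` on `[0,1]^ι`. [this work] -/
theorem combPos_sahiE_biChain [LinearOrder α] [LinearOrder β] (F : Finset ι) (ℓ₁ : Set ι → α) (ℓ₂ : Set ι → β)
    (hℓ₁ : ∀ ω, ℓ₁ ω = ℓ₁ (ω ∩ ↑F)) (hℓ₂ : ∀ ω, ℓ₂ ω = ℓ₂ (ω \ ↑F)) {n : ℕ} (f : Fin n → α × β → ℝ)
    (hf : ∀ i z, 0 ≤ f i z) (hmono : ∀ i, Monotone (f i)) :
    CombPos (fun _ : ι => n) (fun p => sahiE (bernoulliWeight p) n (fun i ω => f i (ℓ₁ ω, ℓ₂ ω))) := by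
  -- the identity: coupling + TCP pulled back
  have key : ∀ p : ι → unitInterval, sahiE (bernoulliWeight p) n (fun i ω => f i (ℓ₁ ω, ℓ₂ ω)) =
      ∑ r : Fin n → α, ∑ c : Fin n → β,
        ((∏ j, pushWeight (bernoulliWeight p) ℓ₁ (r j)) * ∏ j, pushWeight (bernoulliWeight p) ℓ₂ (c j)) *
          et (univ : Finset (Fin n)) (univ : Finset (Fin n)) n (fun i (q : Fin n × Fin n) => f i (r q.1, c q.2)) := by
    intro p
    rw [SahiCombTensor.sahiE_bernoulliWeight_eq_couple p F]
    have hfam : (fun i (q : Set ι × Set ι) => f i (ℓ₁ (q.1 ∩ ↑F ∪ q.2 \ ↑F), ℓ₂ (q.1 ∩ ↑F ∪ q.2 \ ↑F))) =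
        fun i => f i ∘ Prod.map ℓ₁ ℓ₂ := by
      funext i q
      obtain ⟨a, b⟩ := q
      simp only [Function.comp_apply, Prod.map_apply]
      rw [hℓ₁ (a ∩ ↑F ∪ b \ ↑F), SahiCombTensor.couple_inter, ← hℓ₁, hℓ₂ (a ∩ ↑F ∪ b \ ↑F),
        SahiCombTensor.couple_diff, ← hℓ₂]
    rw [hfam]
    exact sahiE_comp_prodMap_eq_sum_et (bernoulliWeight p) (bernoulliWeight p) (sum_bernoulliWeight p) (sum_bernoulliWeight p)
      ℓ₁ ℓ₂ n f
  refine CombPos.congr ?_ fun p => key p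
  refine CombPos.sum _ fun r _ => CombPos.sum _ fun c _ => ?_
  -- the two block products
  have h1 : CombPos (∑ _j : Fin n, fun e => if e ∈ Fᶜ then 0 else 1)
      (fun p => ∏ j, pushWeight (bernoulliWeight p) ℓ₁ (r j)) :=
    CombPos.prod univ fun j _ => combPos_pushWeight_of_block F ℓ₁ hℓ₁ (r j)
  have h2 : CombPos (∑ _j : Fin n, fun e => if e ∈ F then 0 else 1)
      (fun p => ∏ j, pushWeight (bernoulliWeight p) ℓ₂ (c j)) :=
    CombPos.prod univ fun j _ => combPos_pushWeight_of_coblock F ℓ₂ hℓ₂ (c j)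
  have hdeg : (∑ _j : Fin n, fun e => if e ∈ Fᶜ then (0 : ℕ) else 1) + (∑ _j : Fin n, fun e => if e ∈ F then (0 : ℕ) else 1) =
      fun _ : ι => n := by
    funext e
    simp only [Pi.add_apply, Finset.sum_const, Finset.card_univ, Fintype.card_fin, Finset.mem_compl]
    by_cases he : e ∈ F <;> simp [he]
  have h12 := CombPos.mul_of_eq h1 h2 hdeg
  exact (h12.smul (et_coef_nonneg f hf hmono r c)).congr fun p => by ring

end SahiTwoChain

end Summit.CriticalPhenomena.PercolationContinuityZ3.Theorems
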